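import Summits.ABC.ABC.Theses.IsogenyGlueCongruence
import Summits.ABC.ABC.Theorems.SharpDegreeOfPolyDegree.Negative.ExponentFloor

set_option linter.dupNamespace false

/-!
# Crux `SharpDegreeOfPolyDegree` (stmt-ABC-10895): logical position on the positive side

`R := SharpDegreeOfPolyDegree = (Poly → X)` with `X = SemistableDegreeConjecture` (the route's target,
stmt-ABC-2044) and `Poly` the polynomial modular-degree bound for semistable curves.  The negative
side (`¬ R ↔ Poly ∧ ¬ X`, `Theorems/SharpDegreeOfPolyDegree/Negative/LogicalPosition.lean`) is
landed; this support file (lands `--supports stmt-ABC-10895`, registered stub `stub_ofTarget`) records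
the positive side, used by the line lead's report:

* `stub_ofTarget : X → R` — the target closes the crux in one line; `R` carries no evidence
  independent of `X`.
* `semistableDegreeConjecture_iff_poly_and_sharpDegreeOfPolyDegree : X ↔ Poly ∧ R` (`X ⟹ Poly` with
  exponent `3`).
* `sharpDegreeOfPolyDegree_iff_semistableDegreeConjecture_of_poly` : under Poly, `R ↔ X`;
  `sharpDegreeOfPolyDegree_of_not_poly` : without Poly, `R` holds vacuously.  So `R` is exactly
  "`X` in the world where Poly holds", and Poly is not refutable in the tree (every `∀ W ∃ D` statement
  asserts modularity).
* `sharpDegreeOfPolyDegree_iff_forall_gt_two` : `R` is equivalent to its instances with antecedent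
  exponent `κ > 2` (for `κ ≤ 2` the antecedent already gives `X` by monotonicity,
  `Negative.degreeBound_mono`); by the landed exponent floor the free regime is `κ ∈ [3/2, 2]`
  unconditionally and the single point `κ = 2` modulo `PeterssonLowerBound`
  (`sharpDegreeOfPolyDegree_iff_forall_ge_two_of_petersson`).

Theorems only.
-/

noncomputable section

namespace Summit.ABC.ABC.Theorems.SharpDegreeOfPolyDegree

open Summit.ABC.ABC.Theses.IsogenyGlueCongruence
open Literature.NumberTheory.EllipticCurves Literature.NumberTheory.EllipticCurves.ModularForms
open WeierstrassCurve

/-- **Registered stub `stub_ofTarget`: the target closes the crux** — `X → R` in one line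
(`R = Poly → X`).  When `SemistableDegreeConjecture` (stmt-ABC-2044) lands, `SharpDegreeOfPolyDegree`
closes by this lemma. [folklore] -/
theorem stub_ofTarget : SemistableDegreeConjecture → SharpDegreeOfPolyDegree := fun hX _ => hX

/-- `X ⟹ Poly` (with exponent `κ = 3 = 2 + 1`). [folklore] -/
theorem poly_of_semistableDegreeConjecture (hX : SemistableDegreeConjecture) :
    ∃ κ C : ℝ, ∀ (W : WeierstrassCurve ℚ) [W.IsElliptic] [W.IsGloballyMinimal]
      [NeZero (W.conductorNorm ℤ)], W.IsSemistable ℤ →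
        ∃ D : ModularParametrizationData W (W.conductorNorm ℤ),
          (D.modularDegree : ℝ) ≤ C * (W.conductorNorm ℤ : ℝ) ^ κ :=
  ⟨2 + 1, hX 1 one_pos⟩

/-- **`X ↔ Poly ∧ R`**: the target is the conjunction of the crux's antecedent and the crux.
[folklore] -/
theorem semistableDegreeConjecture_iff_poly_and_sharpDegreeOfPolyDegree :
    SemistableDegreeConjecture ↔
      ((∃ κ C : ℝ, ∀ (W : WeierstrassCurve ℚ) [W.IsElliptic] [W.IsGloballyMinimal]
        [NeZero (W.conductorNorm ℤ)], W.IsSemistable ℤ →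
          ∃ D : ModularParametrizationData W (W.conductorNorm ℤ),
            (D.modularDegree : ℝ) ≤ C * (W.conductorNorm ℤ : ℝ) ^ κ) ∧
        SharpDegreeOfPolyDegree) :=
  ⟨fun hX => ⟨poly_of_semistableDegreeConjecture hX, stub_ofTarget hX⟩, fun h => h.2 h.1⟩

/-- **Under Poly, `R` is `X`.** [folklore] -/
theorem sharpDegreeOfPolyDegree_iff_semistableDegreeConjecture_of_poly
    (hPoly : ∃ κ C : ℝ, ∀ (W : WeierstrassCurve ℚ) [W.IsElliptic] [W.IsGloballyMinimal]
      [NeZero (W.conductorNorm ℤ)], W.IsSemistable ℤ →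
        ∃ D : ModularParametrizationData W (W.conductorNorm ℤ),
          (D.modularDegree : ℝ) ≤ C * (W.conductorNorm ℤ : ℝ) ^ κ) :
    SharpDegreeOfPolyDegree ↔ SemistableDegreeConjecture :=
  ⟨fun hR => hR hPoly, stub_ofTarget⟩

/-- **Without Poly, `R` holds vacuously.** [folklore] -/
theorem sharpDegreeOfPolyDegree_of_not_poly
    (h : ¬ ∃ κ C : ℝ, ∀ (W : WeierstrassCurve ℚ) [W.IsElliptic] [W.IsGloballyMinimal]
      [NeZero (W.conductorNorm ℤ)], W.IsSemistable ℤ →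
        ∃ D : ModularParametrizationData W (W.conductorNorm ℤ),
          (D.modularDegree : ℝ) ≤ C * (W.conductorNorm ℤ : ℝ) ^ κ) :
    SharpDegreeOfPolyDegree := fun hPoly => absurd hPoly h

/-- **The free instance of `R`**: an antecedent with exponent `κ ≤ 2` already gives `X`
(monotonicity in the exponent, `Negative.degreeBound_mono`). [folklore] -/
theorem semistableDegreeConjecture_of_degreeBound_le_two {κ : ℝ} (hκ : κ ≤ 2)
    (h : ∃ C : ℝ, ∀ (W : WeierstrassCurve ℚ) [W.IsElliptic] [W.IsGloballyMinimal]
      [NeZero (W.conductorNorm ℤ)], W.IsSemistable ℤ →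
        ∃ D : ModularParametrizationData W (W.conductorNorm ℤ),
          (D.modularDegree : ℝ) ≤ C * (W.conductorNorm ℤ : ℝ) ^ κ) :
    SemistableDegreeConjecture :=
  fun ε hε => Negative.degreeBound_mono (by linarith) h

/-- **`R` is equivalent to its instances with exponent `κ > 2`**, each a genuine exponent drop
`N^κ ↦ N^{2+ε}`; the instances with `κ ≤ 2` are free. [folklore] -/
theorem sharpDegreeOfPolyDegree_iff_forall_gt_two :
    SharpDegreeOfPolyDegree ↔
      ∀ κ : ℝ, 2 < κ →
        (∃ C : ℝ, ∀ (W : WeierstrassCurve ℚ) [W.IsElliptic] [W.IsGloballyMinimal]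
          [NeZero (W.conductorNorm ℤ)], W.IsSemistable ℤ →
            ∃ D : ModularParametrizationData W (W.conductorNorm ℤ),
              (D.modularDegree : ℝ) ≤ C * (W.conductorNorm ℤ : ℝ) ^ κ) →
          SemistableDegreeConjecture := by
  constructor
  · exact fun h κ _ hκ => h ⟨κ, hκ⟩
  · rintro h ⟨κ, hκ⟩
    rcases le_or_gt κ 2 with hle | hlt
    · exact semistableDegreeConjecture_of_degreeBound_le_two hle hκ
    · exact h κ hlt hκ

/-- **Modulo `PeterssonLowerBound` the free regime is the single point `κ = 2`**: `R` is equivalent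
to "if the antecedent holds with some `κ ≥ 2` then it holds with every `κ > 2`" — the admissible
exponents form an upper set disjoint from `(−∞, 2)` (`Negative.not_degreeBound_of_lt_two`), `X` says
it contains `(2, ∞)`, `R` says it does as soon as it is non-empty. [cite: HoffsteinLockhart1994, Thm. 0.1] -/
theorem sharpDegreeOfPolyDegree_iff_forall_ge_two_of_petersson (hP : PeterssonLowerBound) :
    SharpDegreeOfPolyDegree ↔
      ((∃ κ : ℝ, 2 ≤ κ ∧ ∃ C : ℝ, ∀ (W : WeierstrassCurve ℚ) [W.IsElliptic] [W.IsGloballyMinimal]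
          [NeZero (W.conductorNorm ℤ)], W.IsSemistable ℤ →
            ∃ D : ModularParametrizationData W (W.conductorNorm ℤ),
              (D.modularDegree : ℝ) ≤ C * (W.conductorNorm ℤ : ℝ) ^ κ) →
        ∀ κ : ℝ, 2 < κ → ∃ C : ℝ, ∀ (W : WeierstrassCurve ℚ) [W.IsElliptic] [W.IsGloballyMinimal]
          [NeZero (W.conductorNorm ℤ)], W.IsSemistable ℤ →
            ∃ D : ModularParametrizationData W (W.conductorNorm ℤ),
              (D.modularDegree : ℝ) ≤ C * (W.conductorNorm ℤ : ℝ) ^ κ) := by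
  constructor
  · rintro h ⟨κ, -, hκ⟩ κ₁ hκ₁
    have hX := h ⟨κ, hκ⟩
    have := hX (κ₁ - 2) (by linarith)
    rwa [show 2 + (κ₁ - 2) = κ₁ by ring] at this
  · rintro h ⟨κ, hκ⟩ ε hε
    have h2 : 2 ≤ κ := by
      by_contra hlt
      exact Negative.not_degreeBound_of_lt_two hP (not_le.mp hlt) hκ
    exact h ⟨κ, h2, hκ⟩ (2 + ε) (by linarith)

end Summit.ABC.ABC.Theorems.SharpDegreeOfPolyDegree

end
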